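import Summits.BirchSwinnertonDyer.BirchSwinnertonDyer.Theorems.EisensteinPrimesMazurMCOnCellBKernelCertP13TenthCell
import Summits.BirchSwinnertonDyer.BirchSwinnertonDyer.Theorems.EisensteinPrimesMazurMCOnCellBKernelCertP13EleventhCell
import Summits.BirchSwinnertonDyer.BirchSwinnertonDyer.Theorems.EisensteinPrimesMazurMCOnCellBKernelCertP13SeventhCell
import Summits.BirchSwinnertonDyer.BirchSwinnertonDyer.Theorems.EisensteinPrimesMazurMCOnCellBKernelCertP13NinthCell
import Summits.BirchSwinnertonDyer.BirchSwinnertonDyer.Theorems.EisensteinPrimesMazurMCOnCellBKernelCertP13TwelfthCell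
import Summits.BirchSwinnertonDyer.BirchSwinnertonDyer.Theorems.EisensteinPrimesMazurMCOnCellBKernelCertP13ThirteenthCell
import Summits.BirchSwinnertonDyer.BirchSwinnertonDyer.Theorems.EisensteinPrimesMazurMCOnCellBKernelCertP13DoorPriceII
import Summits.BirchSwinnertonDyer.BirchSwinnertonDyer.Theorems.EisensteinPrimesMazurMCOnCellBKernelCertP13DoorPriceClassI
import Literature.NumberTheory.EllipticCurves.PAdicLFunctionQuadraticTwistBirchSharedPrimesProofs
import Literature.NumberTheory.EllipticCurves.RootNumberSmulProofs
import Literature.NumberTheory.EllipticCurves.IsogenyConductorModularityProofs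
import Literature.NumberTheory.QuadraticFields.HeegnerCondition
import HarnessLib

/-!
# Crux 3 `MazurMCOnCellB` (stmt-BirchSwinnertonDyer-19033) — the `p = 13` slice: DOOR PRICE AT THE WHOLE ISOGENY CLASS, part II — for EVERY curve `W₁` isogenous to the
# displayed `E` of an A10-type cell at `13` (granted modularity, which the doors' cone `EisensteinPrimes.PublishedInputs` contains): (i) any field Heegner for `N_{W₁}` has
# `d ≤ −B` (forward two-step edges and the order-one anchor from ANY vertex of the class), and (ii) — NEW — every REVERSE edge `TwoStepAt 13 U W₁` INTO the class has second
# field `K″` with `d_{K″} ≤ −B′` and carries an analytic-rank-ONE certificate for a curve `Wd` with `W₁ ≅ Wd ⊗ χ_{d_{K″}}`: the FIRST STEP of every zig-zag of twistback 6⁷'s left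
# door out of the class is priced in the kernel (`B′ ≤ B` is the residue-level bound: primes of `N_E` may ramify in `K″` — «untwisting»)

Width seat bsd-line-x2-p1-w6 (gen 21), cell `bsd-eis` (run/shared/lean/pub/bsd-eis/), 2026-08-30; `--supports stmt-BirchSwinnertonDyer-19033 --as helper`.
THEOREMS ONLY (no `def`, no named fact, no `sorry`, no instance). Registered line `twistback` v13b is NOT touched; nothing here closes a stub.

WHY. The left door `…_of_connectedClassShaUnit` of the cell files takes `h0 : ∃ W₁ ∼ W, Relation.ReflTransGen (fun A B ↦ TwoStepAt 13 A B ∨ (TwoStepAt 13 B A ∧ CellB B)) W₁ U ∧ …`: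
the zig-zag may start at ANY model `W₁` of ANY curve isogenous to `E`, and its first step may be an edge OUT of `W₁` (priced by `…DoorPrice`/`…DoorPriceII` at `W₁ = E, E′`
only) or an edge INTO `W₁` (not priced so far; memo §1.5 numerics). This file prices both at the class level.
HOW. §0: `dvd_conductorNorm_of_smul_eq_quadraticTwist` — if `C • W = Wd ⊗ χ_d` (`d ≡ 1 (mod 4)`) and `q ∣ N_W`, `q ∤ d`, then `q ∣ N_{Wd}` (the conductor exponent at `q ∤ d` is
twist-invariant: `factorization_conductorNorm_quadraticTwist_eq_of_not_dvd`; isomorphism-invariant: `conductorExponent_smul'`); the engine `discr_le_of_twoStepAt_into_of_check`: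
unfolding `TwoStepAt 13 U W` (`K`, `Wd ≅ U^{(d_K)}` with `r_an = 1`, `K″` Heegner for `N_{Wd}` and `13`, `C • W = Wd ⊗ χ_{d_{K″}}`), every prime `q ∣ N_W` either divides `d_{K″}`
or divides `N_{Wd}` hence SPLITS in `K″` (`d ≡ 1 (mod 8)` at `2` — `d` odd —, Euler's criterion at odd `q`; `13` splits by `K″`'s own hypothesis); a finite residue check over
`D ∈ (−B′, −4)` (`decide +kernel`) closes `d_{K″} ≤ −B′`; `Wd.analyticRank = 1` from `r_an(U^{(d_K)}) = 1` by `analyticRank_smul`. §k per cell: `bad_dvd_conductorNorm_<tag>`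
(the bad primes divide `N_E`, kernel), transported to any `W₁ ∼ E` by `ModularForms.conductorNorm_eq_of_isIsogenous_of_modularity hmod` (Atkin–Lehner: isogenous curves have
equal conductor, granted modularity); then `discr_le_of_heegner_isogenous_<tag>` (forward/anchor, from the landed `discr_le_of_heegner_<tag>`) and
`twoStepAt_into_isogenous_<tag>` (reverse). CELLS: T (−46/13 ⊗ χ₋₆₈₁₅ (A10 #10, w6 g21)): N = 1360908680950, B = 199, B′ = 199; U (−46/13 ⊗ χ₋₄₅₀₁ (A10 #11, Ш_an = 13²·3², w6 g21)): N = 81508930119344, B = 103, B′ = 103; V (−46/13 ⊗ χ₋₁₅₈₃ (g20 #7, file w6 g21)): N = 61752577520998, B = 103, B′ = 103; W (−46/13 ⊗ χ₋₂₆₇₉ (g20 #9, file w6 g21)): N = 176863692176262, B = 2159, B′ = 1167; X (−46/13 ⊗ χ₋₃₉₆₂ (A10 #12, w6 g21)): N = 63156217132736, B = 1167, B′ = 1167; Y (−46/13 ⊗ χ₋₉₈₃₁ (A10 #13, w6 g21)): N = 2831996134422, B = 2495, B′ = 615. NUMERICS (memo §1.5, not kernel): with Tate's algorithm on the twists the true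 least reverse fields are
−335 (g19), −1095 (A; conductor of `E^{(−1095)}` = 4.27·10¹⁴), −599 (B), −1095 (C; 3.1·10¹⁷), −1223 (I), −1167 (#9; 3.0·10¹⁸), −615 (#13; 1.3·10¹⁶), else `= −B`; the
kernel `B′` here is the weaker residue-level bound (it cannot see whether an untwisted prime really leaves the conductor).
HONEST FRAMING: elementary kernel facts about explicit equations, conductors of twists and quadratic residues, CONDITIONAL on `nonempty_modularParametrizationData` (modularity,
a conjunct of the doors' own cone) for the class transport only; nothing about any L-value, Selmer group, main conjecture or BSD is asserted; the doors stay CONDITIONAL and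
un-instantiated; closes no registered stub; 0 cells / labels / stubs / tiers move; no summit statement, no case of Mazur's main conjecture and no case of BSD is proved for any
curve. Memo of record: `P13-DESCENT-ATLAS-w6g21.md` §1 (evidence on -19033); mirror `HOME/line-x2-p1-w6-g21/`.
References: [GrossLMS1991] §1; [AtkinLehner1970] Thm. 4; [SilvermanATAEC1994] IV.9.4, IV.10, Exercise 4.40; [SilvermanAEC2009] App. C §16; [IrelandRosen1990] Prop. 13.1.3–13.1.4;
this lane's `…KernelCertP13DoorPrice` (p764408), `…DoorPriceII`, `…DoorPriceSharp`, x2-p1-w6 g3 `…TwistbackTwoStepDefs`.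
-/

set_option autoImplicit false
-- `Summit.BirchSwinnertonDyer.BirchSwinnertonDyer.…`: the summit and its single sub-problem share a name.
set_option linter.dupNamespace false

noncomputable section

open scoped Classical
open WeierstrassCurve NumberField Literature.NumberTheory.EllipticCurves
  Literature.NumberTheory.EllipticCurves.ModularForms
  Literature.NumberTheory.QuadraticFields
  Summit.BirchSwinnertonDyer.BirchSwinnertonDyer.Rank1Residual.X11RankOne
  Summit.BirchSwinnertonDyer.BirchSwinnertonDyer.Theorems
  Summit.BirchSwinnertonDyer.BirchSwinnertonDyer.Theorems.EisensteinPrimesMazurMCOnCellBTwistbackTwoStepDefs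
  Summit.BirchSwinnertonDyer.BirchSwinnertonDyer.Theorems.EisensteinPrimesMazurMCOnCellBKernelCertP13DoorPrice

namespace Summit.BirchSwinnertonDyer.BirchSwinnertonDyer.Theorems.EisensteinPrimesMazurMCOnCellBKernelCertP13DoorPriceClassII


open Summit.BirchSwinnertonDyer.BirchSwinnertonDyer.Theorems.EisensteinPrimesMazurMCOnCellBKernelCertP13DoorPriceClassI

/-! ## Cell T — −46/13 ⊗ χ₋₆₈₁₅ (A10 #10, w6 g21), `N = 1360908680950`, bad primes `{2} ∪ [5, 7, 13, 23, 29, 47]`: forward/anchor `B = 199`, reverse `B′ = 199` -/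

/-- The bad primes `{2} ∪ [5, 7, 13, 23, 29, 47]` all divide `N_E` (kernel: `…DoorPrice.dvd_conductorNorm_of_dvd_Δ` from the integer equation). [cite: BombieriGubler2006, 12.5.9(d)] -/
theorem bad_dvd_conductorNorm_e13a17 : ∀ q ∈ ((2 :: [5, 7, 13, 23, 29, 47]) : List ℕ), q ∣ (⟨1, -1, 1, -3631263220787355, 85339578849437030591897⟩ : WeierstrassCurve ℚ).conductorNorm ℤ := by
  haveI := EisensteinPrimesMazurMCOnCellBKernelCertP13TenthCell.isElliptic_e13a17; haveI := EisensteinPrimesMazurMCOnCellBKernelCertP13TenthCell.isGloballyMinimal_e13a17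
  have hb := baseChange_mk_int 1 (-1) 1 (-3631263220787355) 85339578849437030591897
  push_cast at hb
  intro q hq; fin_cases hq <;> exact dvd_conductorNorm_of_dvd_Δ _ hb (by norm_num) (by rw [intCurve_Δ]; decide +kernel)

/-- **Forward edges and anchors from ANY curve `W₁` isogenous to `E` (cell T): a field Heegner for `N_{W₁}` with `d < −4` has `d ≤ −199`** — `N_{W₁} = N_E` granted modularity
(`ModularForms.conductorNorm_eq_of_isIsogenous_of_modularity`, Atkin–Lehner) and the landed `discr_le_of_heegner_e13a17`. [cite: AtkinLehner1970, Thm. 4] [cite: GrossLMS1991, §1 (p. 235)] -/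
theorem discr_le_of_heegner_isogenous_e13a17 (hmod : nonempty_modularParametrizationData) (W₁ : WeierstrassCurve ℚ) [W₁.IsElliptic]
    (hiso : IsIsogenous (⟨1, -1, 1, -3631263220787355, 85339578849437030591897⟩ : WeierstrassCurve ℚ) W₁) (K₀ : Type) [Field K₀] [NumberField K₀] (hK : IsImaginaryQuadratic K₀)
    (hHN : SatisfiesHeegnerHypothesis (W₁.conductorNorm ℤ) K₀) (hlt : NumberField.discr K₀ < -4) : NumberField.discr K₀ ≤ -199 := by
  haveI := EisensteinPrimesMazurMCOnCellBKernelCertP13TenthCell.isElliptic_e13a17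
  rw [← conductorNorm_eq_of_isIsogenous_of_modularity hmod _ W₁ hiso] at hHN
  exact EisensteinPrimesMazurMCOnCellBKernelCertP13DoorPriceII.discr_le_of_heegner_e13a17 K₀ hK hHN hlt

/-- Finite residue check for reverse edges at cell T: no `D ∈ (−199, −4)` with `D ≡ 1 (8)`, `(D/13) = 1` and `q ∣ D ∨ (D/q) = 1` for `q ∈ [5, 7, 13, 23, 29, 47]`. [folklore] -/
theorem no_reverse_discr_e13a17 : ∀ D ∈ Finset.Ioo (-199 : ℤ) (-4), D % 8 = 1 → (D : ZMod 13) ^ 6 = 1 →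
    (∀ q ∈ ([5, 7, 13, 23, 29, 47] : List ℕ), (q : ℤ) ∣ D ∨ (D : ZMod q) ^ (q / 2) = 1) → False := by
  decide +kernel

/-- **REVERSE edges into ANY curve `W₁` isogenous to `E` (cell T): every `TwoStepAt 13 U W₁` has second field `K″` with `d_{K″} ≤ −199` and carries an analytic-rank-ONE
certificate for a curve `Wd` with `W₁ ≅ Wd ⊗ χ_{d_{K″}}`** (granted modularity for `N_{W₁} = N_E`). The first step of every zig-zag of 6⁷'s left door out of the class of `E` is thus an
`L`-reading: forward `r_an(W₁^{(d)}) = 1`, `|d| ≥ 199`, or reverse `r_an(Wd) = 1`, `Wd ≅ W₁ ⊗ χ_d`, `|d| ≥ 199`. [cite: GrossLMS1991, §1 (p. 235)] [cite: AtkinLehner1970, Thm. 4] -/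
theorem twoStepAt_into_isogenous_e13a17 (hmod : nonempty_modularParametrizationData) (W₁ : WeierstrassCurve ℚ) [W₁.IsElliptic]
    (hiso : IsIsogenous (⟨1, -1, 1, -3631263220787355, 85339578849437030591897⟩ : WeierstrassCurve ℚ) W₁) (U : WeierstrassCurve ℚ) (h : TwoStepAt 13 U W₁) :
    ∃ (K : Type) (_ : Field K) (_ : NumberField K), IsImaginaryQuadratic K ∧ NumberField.discr K ≤ -199 ∧
      ∃ (Wd : WeierstrassCurve ℚ) (_ : Wd.IsElliptic) (_ : Wd.IsGloballyMinimal),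
        (∃ C : VariableChange ℚ, C • W₁ = Wd.quadraticTwist (NumberField.discr K : ℚ)) ∧ Wd.analyticRank = 1 := by
  haveI := EisensteinPrimesMazurMCOnCellBKernelCertP13TenthCell.isElliptic_e13a17
  have hN := conductorNorm_eq_of_isIsogenous_of_modularity hmod _ W₁ hiso
  have hb := bad_dvd_conductorNorm_e13a17
  exact discr_le_of_twoStepAt_into_of_check [5, 7, 13, 23, 29, 47] (hN ▸ hb 2 (by simp)) (by intro q hq; fin_cases hq <;> exact ⟨by norm_num, by decide, hN ▸ hb _ (by simp)⟩)
    (-199) no_reverse_discr_e13a17 U h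

/-! ## Cell U — −46/13 ⊗ χ₋₄₅₀₁ (A10 #11, Ш_an = 13²·3², w6 g21), `N = 81508930119344`, bad primes `{2} ∪ [7, 13, 23, 29, 643]`: forward/anchor `B = 103`, reverse `B′ = 103` -/

/-- The bad primes `{2} ∪ [7, 13, 23, 29, 643]` all divide `N_E` (kernel: `…DoorPrice.dvd_conductorNorm_of_dvd_Δ` from the integer equation). [cite: BombieriGubler2006, 12.5.9(d)] -/
theorem bad_dvd_conductorNorm_e13a18 : ∀ q ∈ ((2 :: [7, 13, 23, 29, 643]) : List ℕ), q ∣ (⟨0, 0, 0, -25343349868344403, 1573475274969726091051410⟩ : WeierstrassCurve ℚ).conductorNorm ℤ := by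
  haveI := EisensteinPrimesMazurMCOnCellBKernelCertP13EleventhCell.isElliptic_e13a18; haveI := EisensteinPrimesMazurMCOnCellBKernelCertP13EleventhCell.isGloballyMinimal_e13a18
  have hb := baseChange_mk_int 0 0 0 (-25343349868344403) 1573475274969726091051410
  push_cast at hb
  intro q hq; fin_cases hq <;> exact dvd_conductorNorm_of_dvd_Δ _ hb (by norm_num) (by rw [intCurve_Δ]; decide +kernel)

/-- **Forward edges and anchors from ANY curve `W₁` isogenous to `E` (cell U): a field Heegner for `N_{W₁}` with `d < −4` has `d ≤ −103`** — `N_{W₁} = N_E` granted modularity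
(`ModularForms.conductorNorm_eq_of_isIsogenous_of_modularity`, Atkin–Lehner) and the landed `discr_le_of_heegner_e13a18`. [cite: AtkinLehner1970, Thm. 4] [cite: GrossLMS1991, §1 (p. 235)] -/
theorem discr_le_of_heegner_isogenous_e13a18 (hmod : nonempty_modularParametrizationData) (W₁ : WeierstrassCurve ℚ) [W₁.IsElliptic]
    (hiso : IsIsogenous (⟨0, 0, 0, -25343349868344403, 1573475274969726091051410⟩ : WeierstrassCurve ℚ) W₁) (K₀ : Type) [Field K₀] [NumberField K₀] (hK : IsImaginaryQuadratic K₀)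
    (hHN : SatisfiesHeegnerHypothesis (W₁.conductorNorm ℤ) K₀) (hlt : NumberField.discr K₀ < -4) : NumberField.discr K₀ ≤ -103 := by
  haveI := EisensteinPrimesMazurMCOnCellBKernelCertP13EleventhCell.isElliptic_e13a18
  rw [← conductorNorm_eq_of_isIsogenous_of_modularity hmod _ W₁ hiso] at hHN
  exact EisensteinPrimesMazurMCOnCellBKernelCertP13DoorPriceII.discr_le_of_heegner_e13a18 K₀ hK hHN hlt

/-- Finite residue check for reverse edges at cell U: no `D ∈ (−103, −4)` with `D ≡ 1 (8)`, `(D/13) = 1` and `q ∣ D ∨ (D/q) = 1` for `q ∈ [7, 13, 23, 29, 643]`. [folklore] -/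
theorem no_reverse_discr_e13a18 : ∀ D ∈ Finset.Ioo (-103 : ℤ) (-4), D % 8 = 1 → (D : ZMod 13) ^ 6 = 1 →
    (∀ q ∈ ([7, 13, 23, 29, 643] : List ℕ), (q : ℤ) ∣ D ∨ (D : ZMod q) ^ (q / 2) = 1) → False := by
  decide +kernel

/-- **REVERSE edges into ANY curve `W₁` isogenous to `E` (cell U): every `TwoStepAt 13 U W₁` has second field `K″` with `d_{K″} ≤ −103` and carries an analytic-rank-ONE
certificate for a curve `Wd` with `W₁ ≅ Wd ⊗ χ_{d_{K″}}`** (granted modularity for `N_{W₁} = N_E`). The first step of every zig-zag of 6⁷'s left door out of the class of `E` is thus an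
`L`-reading: forward `r_an(W₁^{(d)}) = 1`, `|d| ≥ 103`, or reverse `r_an(Wd) = 1`, `Wd ≅ W₁ ⊗ χ_d`, `|d| ≥ 103`. [cite: GrossLMS1991, §1 (p. 235)] [cite: AtkinLehner1970, Thm. 4] -/
theorem twoStepAt_into_isogenous_e13a18 (hmod : nonempty_modularParametrizationData) (W₁ : WeierstrassCurve ℚ) [W₁.IsElliptic]
    (hiso : IsIsogenous (⟨0, 0, 0, -25343349868344403, 1573475274969726091051410⟩ : WeierstrassCurve ℚ) W₁) (U : WeierstrassCurve ℚ) (h : TwoStepAt 13 U W₁) :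
    ∃ (K : Type) (_ : Field K) (_ : NumberField K), IsImaginaryQuadratic K ∧ NumberField.discr K ≤ -103 ∧
      ∃ (Wd : WeierstrassCurve ℚ) (_ : Wd.IsElliptic) (_ : Wd.IsGloballyMinimal),
        (∃ C : VariableChange ℚ, C • W₁ = Wd.quadraticTwist (NumberField.discr K : ℚ)) ∧ Wd.analyticRank = 1 := by
  haveI := EisensteinPrimesMazurMCOnCellBKernelCertP13EleventhCell.isElliptic_e13a18
  have hN := conductorNorm_eq_of_isIsogenous_of_modularity hmod _ W₁ hiso
  have hb := bad_dvd_conductorNorm_e13a18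
  exact discr_le_of_twoStepAt_into_of_check [7, 13, 23, 29, 643] (hN ▸ hb 2 (by simp)) (by intro q hq; fin_cases hq <;> exact ⟨by norm_num, by decide, hN ▸ hb _ (by simp)⟩)
    (-103) no_reverse_discr_e13a18 U h

/-! ## Cell V — −46/13 ⊗ χ₋₁₅₈₃ (g20 #7, file w6 g21), `N = 61752577520998`, bad primes `{2} ∪ [7, 13, 23, 29, 1583]`: forward/anchor `B = 103`, reverse `B′ = 103` -/

/-- The bad primes `{2} ∪ [7, 13, 23, 29, 1583]` all divide `N_E` (kernel: `…DoorPrice.dvd_conductorNorm_of_dvd_Δ` from the integer equation). [cite: BombieriGubler2006, 12.5.9(d)] -/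
theorem bad_dvd_conductorNorm_e13a19 : ∀ q ∈ ((2 :: [7, 13, 23, 29, 1583]) : List ℕ), q ∣ (⟨1, -1, 1, -195924090908517, 1069536658430224254155⟩ : WeierstrassCurve ℚ).conductorNorm ℤ := by
  haveI := EisensteinPrimesMazurMCOnCellBKernelCertP13SeventhCell.isElliptic_e13a19; haveI := EisensteinPrimesMazurMCOnCellBKernelCertP13SeventhCell.isGloballyMinimal_e13a19
  have hb := baseChange_mk_int 1 (-1) 1 (-195924090908517) 1069536658430224254155
  push_cast at hb
  intro q hq; fin_cases hq <;> exact dvd_conductorNorm_of_dvd_Δ _ hb (by norm_num) (by rw [intCurve_Δ]; decide +kernel)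

/-- **Forward edges and anchors from ANY curve `W₁` isogenous to `E` (cell V): a field Heegner for `N_{W₁}` with `d < −4` has `d ≤ −103`** — `N_{W₁} = N_E` granted modularity
(`ModularForms.conductorNorm_eq_of_isIsogenous_of_modularity`, Atkin–Lehner) and the landed `discr_le_of_heegner_e13a19`. [cite: AtkinLehner1970, Thm. 4] [cite: GrossLMS1991, §1 (p. 235)] -/
theorem discr_le_of_heegner_isogenous_e13a19 (hmod : nonempty_modularParametrizationData) (W₁ : WeierstrassCurve ℚ) [W₁.IsElliptic]
    (hiso : IsIsogenous (⟨1, -1, 1, -195924090908517, 1069536658430224254155⟩ : WeierstrassCurve ℚ) W₁) (K₀ : Type) [Field K₀] [NumberField K₀] (hK : IsImaginaryQuadratic K₀)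
    (hHN : SatisfiesHeegnerHypothesis (W₁.conductorNorm ℤ) K₀) (hlt : NumberField.discr K₀ < -4) : NumberField.discr K₀ ≤ -103 := by
  haveI := EisensteinPrimesMazurMCOnCellBKernelCertP13SeventhCell.isElliptic_e13a19
  rw [← conductorNorm_eq_of_isIsogenous_of_modularity hmod _ W₁ hiso] at hHN
  exact EisensteinPrimesMazurMCOnCellBKernelCertP13DoorPriceII.discr_le_of_heegner_e13a19 K₀ hK hHN hlt

/-- Finite residue check for reverse edges at cell V: no `D ∈ (−103, −4)` with `D ≡ 1 (8)`, `(D/13) = 1` and `q ∣ D ∨ (D/q) = 1` for `q ∈ [7, 13, 23, 29, 1583]`. [folklore] -/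
theorem no_reverse_discr_e13a19 : ∀ D ∈ Finset.Ioo (-103 : ℤ) (-4), D % 8 = 1 → (D : ZMod 13) ^ 6 = 1 →
    (∀ q ∈ ([7, 13, 23, 29, 1583] : List ℕ), (q : ℤ) ∣ D ∨ (D : ZMod q) ^ (q / 2) = 1) → False := by
  decide +kernel

/-- **REVERSE edges into ANY curve `W₁` isogenous to `E` (cell V): every `TwoStepAt 13 U W₁` has second field `K″` with `d_{K″} ≤ −103` and carries an analytic-rank-ONE
certificate for a curve `Wd` with `W₁ ≅ Wd ⊗ χ_{d_{K″}}`** (granted modularity for `N_{W₁} = N_E`). The first step of every zig-zag of 6⁷'s left door out of the class of `E` is thus an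
`L`-reading: forward `r_an(W₁^{(d)}) = 1`, `|d| ≥ 103`, or reverse `r_an(Wd) = 1`, `Wd ≅ W₁ ⊗ χ_d`, `|d| ≥ 103`. [cite: GrossLMS1991, §1 (p. 235)] [cite: AtkinLehner1970, Thm. 4] -/
theorem twoStepAt_into_isogenous_e13a19 (hmod : nonempty_modularParametrizationData) (W₁ : WeierstrassCurve ℚ) [W₁.IsElliptic]
    (hiso : IsIsogenous (⟨1, -1, 1, -195924090908517, 1069536658430224254155⟩ : WeierstrassCurve ℚ) W₁) (U : WeierstrassCurve ℚ) (h : TwoStepAt 13 U W₁) :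
    ∃ (K : Type) (_ : Field K) (_ : NumberField K), IsImaginaryQuadratic K ∧ NumberField.discr K ≤ -103 ∧
      ∃ (Wd : WeierstrassCurve ℚ) (_ : Wd.IsElliptic) (_ : Wd.IsGloballyMinimal),
        (∃ C : VariableChange ℚ, C • W₁ = Wd.quadraticTwist (NumberField.discr K : ℚ)) ∧ Wd.analyticRank = 1 := by
  haveI := EisensteinPrimesMazurMCOnCellBKernelCertP13SeventhCell.isElliptic_e13a19
  have hN := conductorNorm_eq_of_isIsogenous_of_modularity hmod _ W₁ hiso
  have hb := bad_dvd_conductorNorm_e13a19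
  exact discr_le_of_twoStepAt_into_of_check [7, 13, 23, 29, 1583] (hN ▸ hb 2 (by simp)) (by intro q hq; fin_cases hq <;> exact ⟨by norm_num, by decide, hN ▸ hb _ (by simp)⟩)
    (-103) no_reverse_discr_e13a19 U h

/-! ## Cell W — −46/13 ⊗ χ₋₂₆₇₉ (g20 #9, file w6 g21), `N = 176863692176262`, bad primes `{2} ∪ [3, 7, 13, 19, 23, 29, 47]`: forward/anchor `B = 2159`, reverse `B′ = 1167` -/

/-- The bad primes `{2} ∪ [3, 7, 13, 19, 23, 29, 47]` all divide `N_E` (kernel: `…DoorPrice.dvd_conductorNorm_of_dvd_Δ` from the integer equation). [cite: BombieriGubler2006, 12.5.9(d)] -/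
theorem bad_dvd_conductorNorm_e13a20 : ∀ q ∈ ((2 :: [3, 7, 13, 19, 23, 29, 47]) : List ℕ), q ∣ (⟨1, -1, 1, -561140271312158, 5184072454112665382539⟩ : WeierstrassCurve ℚ).conductorNorm ℤ := by
  haveI := EisensteinPrimesMazurMCOnCellBKernelCertP13NinthCell.isElliptic_e13a20; haveI := EisensteinPrimesMazurMCOnCellBKernelCertP13NinthCell.isGloballyMinimal_e13a20
  have hb := baseChange_mk_int 1 (-1) 1 (-561140271312158) 5184072454112665382539
  push_cast at hb
  intro q hq; fin_cases hq <;> exact dvd_conductorNorm_of_dvd_Δ _ hb (by norm_num) (by rw [intCurve_Δ]; decide +kernel)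

/-- **Forward edges and anchors from ANY curve `W₁` isogenous to `E` (cell W): a field Heegner for `N_{W₁}` with `d < −4` has `d ≤ −2159`** — `N_{W₁} = N_E` granted modularity
(`ModularForms.conductorNorm_eq_of_isIsogenous_of_modularity`, Atkin–Lehner) and the landed `discr_le_of_heegner_e13a20`. [cite: AtkinLehner1970, Thm. 4] [cite: GrossLMS1991, §1 (p. 235)] -/
theorem discr_le_of_heegner_isogenous_e13a20 (hmod : nonempty_modularParametrizationData) (W₁ : WeierstrassCurve ℚ) [W₁.IsElliptic]
    (hiso : IsIsogenous (⟨1, -1, 1, -561140271312158, 5184072454112665382539⟩ : WeierstrassCurve ℚ) W₁) (K₀ : Type) [Field K₀] [NumberField K₀] (hK : IsImaginaryQuadratic K₀)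
    (hHN : SatisfiesHeegnerHypothesis (W₁.conductorNorm ℤ) K₀) (hlt : NumberField.discr K₀ < -4) : NumberField.discr K₀ ≤ -2159 := by
  haveI := EisensteinPrimesMazurMCOnCellBKernelCertP13NinthCell.isElliptic_e13a20
  rw [← conductorNorm_eq_of_isIsogenous_of_modularity hmod _ W₁ hiso] at hHN
  exact EisensteinPrimesMazurMCOnCellBKernelCertP13DoorPriceII.discr_le_of_heegner_e13a20 K₀ hK hHN hlt

/-- Finite residue check for reverse edges at cell W: no `D ∈ (−1167, −4)` with `D ≡ 1 (8)`, `(D/13) = 1` and `q ∣ D ∨ (D/q) = 1` for `q ∈ [3, 7, 13, 19, 23, 29, 47]`. [folklore] -/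
theorem no_reverse_discr_e13a20 : ∀ D ∈ Finset.Ioo (-1167 : ℤ) (-4), D % 8 = 1 → (D : ZMod 13) ^ 6 = 1 →
    (∀ q ∈ ([3, 7, 13, 19, 23, 29, 47] : List ℕ), (q : ℤ) ∣ D ∨ (D : ZMod q) ^ (q / 2) = 1) → False := by
  decide +kernel

/-- **REVERSE edges into ANY curve `W₁` isogenous to `E` (cell W): every `TwoStepAt 13 U W₁` has second field `K″` with `d_{K″} ≤ −1167` and carries an analytic-rank-ONE
certificate for a curve `Wd` with `W₁ ≅ Wd ⊗ χ_{d_{K″}}`** (granted modularity for `N_{W₁} = N_E`). The first step of every zig-zag of 6⁷'s left door out of the class of `E` is thus an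
`L`-reading: forward `r_an(W₁^{(d)}) = 1`, `|d| ≥ 2159`, or reverse `r_an(Wd) = 1`, `Wd ≅ W₁ ⊗ χ_d`, `|d| ≥ 1167`. [cite: GrossLMS1991, §1 (p. 235)] [cite: AtkinLehner1970, Thm. 4] -/
theorem twoStepAt_into_isogenous_e13a20 (hmod : nonempty_modularParametrizationData) (W₁ : WeierstrassCurve ℚ) [W₁.IsElliptic]
    (hiso : IsIsogenous (⟨1, -1, 1, -561140271312158, 5184072454112665382539⟩ : WeierstrassCurve ℚ) W₁) (U : WeierstrassCurve ℚ) (h : TwoStepAt 13 U W₁) :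
    ∃ (K : Type) (_ : Field K) (_ : NumberField K), IsImaginaryQuadratic K ∧ NumberField.discr K ≤ -1167 ∧
      ∃ (Wd : WeierstrassCurve ℚ) (_ : Wd.IsElliptic) (_ : Wd.IsGloballyMinimal),
        (∃ C : VariableChange ℚ, C • W₁ = Wd.quadraticTwist (NumberField.discr K : ℚ)) ∧ Wd.analyticRank = 1 := by
  haveI := EisensteinPrimesMazurMCOnCellBKernelCertP13NinthCell.isElliptic_e13a20
  have hN := conductorNorm_eq_of_isIsogenous_of_modularity hmod _ W₁ hiso
  have hb := bad_dvd_conductorNorm_e13a20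
  exact discr_le_of_twoStepAt_into_of_check [3, 7, 13, 19, 23, 29, 47] (hN ▸ hb 2 (by simp)) (by intro q hq; fin_cases hq <;> exact ⟨by norm_num, by decide, hN ▸ hb _ (by simp)⟩)
    (-1167) no_reverse_discr_e13a20 U h

/-! ## Cell X — −46/13 ⊗ χ₋₃₉₆₂ (A10 #12, w6 g21), `N = 63156217132736`, bad primes `{2} ∪ [7, 13, 23, 29, 283]`: forward/anchor `B = 1167`, reverse `B′ = 1167` -/

/-- The bad primes `{2} ∪ [7, 13, 23, 29, 283]` all divide `N_E` (kernel: `…DoorPrice.dvd_conductorNorm_of_dvd_Δ` from the integer equation). [cite: BombieriGubler2006, 12.5.9(d)] -/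
theorem bad_dvd_conductorNorm_e13a21 : ∀ q ∈ ((2 :: [7, 13, 23, 29, 283]) : List ℕ), q ∣ (⟨0, 0, 0, -19636990754417932, 1073189210454698748030480⟩ : WeierstrassCurve ℚ).conductorNorm ℤ := by
  haveI := EisensteinPrimesMazurMCOnCellBKernelCertP13TwelfthCell.isElliptic_e13a21; haveI := EisensteinPrimesMazurMCOnCellBKernelCertP13TwelfthCell.isGloballyMinimal_e13a21
  have hb := baseChange_mk_int 0 0 0 (-19636990754417932) 1073189210454698748030480
  push_cast at hb
  intro q hq; fin_cases hq <;> exact dvd_conductorNorm_of_dvd_Δ _ hb (by norm_num) (by rw [intCurve_Δ]; decide +kernel)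

/-- **Forward edges and anchors from ANY curve `W₁` isogenous to `E` (cell X): a field Heegner for `N_{W₁}` with `d < −4` has `d ≤ −1167`** — `N_{W₁} = N_E` granted modularity
(`ModularForms.conductorNorm_eq_of_isIsogenous_of_modularity`, Atkin–Lehner) and the landed `discr_le_of_heegner_e13a21`. [cite: AtkinLehner1970, Thm. 4] [cite: GrossLMS1991, §1 (p. 235)] -/
theorem discr_le_of_heegner_isogenous_e13a21 (hmod : nonempty_modularParametrizationData) (W₁ : WeierstrassCurve ℚ) [W₁.IsElliptic]
    (hiso : IsIsogenous (⟨0, 0, 0, -19636990754417932, 1073189210454698748030480⟩ : WeierstrassCurve ℚ) W₁) (K₀ : Type) [Field K₀] [NumberField K₀] (hK : IsImaginaryQuadratic K₀)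
    (hHN : SatisfiesHeegnerHypothesis (W₁.conductorNorm ℤ) K₀) (hlt : NumberField.discr K₀ < -4) : NumberField.discr K₀ ≤ -1167 := by
  haveI := EisensteinPrimesMazurMCOnCellBKernelCertP13TwelfthCell.isElliptic_e13a21
  rw [← conductorNorm_eq_of_isIsogenous_of_modularity hmod _ W₁ hiso] at hHN
  exact EisensteinPrimesMazurMCOnCellBKernelCertP13DoorPriceII.discr_le_of_heegner_e13a21 K₀ hK hHN hlt

/-- Finite residue check for reverse edges at cell X: no `D ∈ (−1167, −4)` with `D ≡ 1 (8)`, `(D/13) = 1` and `q ∣ D ∨ (D/q) = 1` for `q ∈ [7, 13, 23, 29, 283]`. [folklore] -/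
theorem no_reverse_discr_e13a21 : ∀ D ∈ Finset.Ioo (-1167 : ℤ) (-4), D % 8 = 1 → (D : ZMod 13) ^ 6 = 1 →
    (∀ q ∈ ([7, 13, 23, 29, 283] : List ℕ), (q : ℤ) ∣ D ∨ (D : ZMod q) ^ (q / 2) = 1) → False := by
  decide +kernel

/-- **REVERSE edges into ANY curve `W₁` isogenous to `E` (cell X): every `TwoStepAt 13 U W₁` has second field `K″` with `d_{K″} ≤ −1167` and carries an analytic-rank-ONE
certificate for a curve `Wd` with `W₁ ≅ Wd ⊗ χ_{d_{K″}}`** (granted modularity for `N_{W₁} = N_E`). The first step of every zig-zag of 6⁷'s left door out of the class of `E` is thus an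
`L`-reading: forward `r_an(W₁^{(d)}) = 1`, `|d| ≥ 1167`, or reverse `r_an(Wd) = 1`, `Wd ≅ W₁ ⊗ χ_d`, `|d| ≥ 1167`. [cite: GrossLMS1991, §1 (p. 235)] [cite: AtkinLehner1970, Thm. 4] -/
theorem twoStepAt_into_isogenous_e13a21 (hmod : nonempty_modularParametrizationData) (W₁ : WeierstrassCurve ℚ) [W₁.IsElliptic]
    (hiso : IsIsogenous (⟨0, 0, 0, -19636990754417932, 1073189210454698748030480⟩ : WeierstrassCurve ℚ) W₁) (U : WeierstrassCurve ℚ) (h : TwoStepAt 13 U W₁) :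
    ∃ (K : Type) (_ : Field K) (_ : NumberField K), IsImaginaryQuadratic K ∧ NumberField.discr K ≤ -1167 ∧
      ∃ (Wd : WeierstrassCurve ℚ) (_ : Wd.IsElliptic) (_ : Wd.IsGloballyMinimal),
        (∃ C : VariableChange ℚ, C • W₁ = Wd.quadraticTwist (NumberField.discr K : ℚ)) ∧ Wd.analyticRank = 1 := by
  haveI := EisensteinPrimesMazurMCOnCellBKernelCertP13TwelfthCell.isElliptic_e13a21
  have hN := conductorNorm_eq_of_isIsogenous_of_modularity hmod _ W₁ hiso
  have hb := bad_dvd_conductorNorm_e13a21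
  exact discr_le_of_twoStepAt_into_of_check [7, 13, 23, 29, 283] (hN ▸ hb 2 (by simp)) (by intro q hq; fin_cases hq <;> exact ⟨by norm_num, by decide, hN ▸ hb _ (by simp)⟩)
    (-1167) no_reverse_discr_e13a21 U h

/-! ## Cell Y — −46/13 ⊗ χ₋₉₈₃₁ (A10 #13, w6 g21), `N = 2831996134422`, bad primes `{2} ∪ [3, 7, 13, 23, 29, 113]`: forward/anchor `B = 2495`, reverse `B′ = 615` -/

/-- The bad primes `{2} ∪ [3, 7, 13, 23, 29, 113]` all divide `N_E` (kernel: `…DoorPrice.dvd_conductorNorm_of_dvd_Δ` from the integer equation). [cite: BombieriGubler2006, 12.5.9(d)] -/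
theorem bad_dvd_conductorNorm_e13a22 : ∀ q ∈ ((2 :: [3, 7, 13, 23, 29, 113]) : List ℕ), q ∣ (⟨1, -1, 1, -7556512459866068, 256180460309112042534709⟩ : WeierstrassCurve ℚ).conductorNorm ℤ := by
  haveI := EisensteinPrimesMazurMCOnCellBKernelCertP13ThirteenthCell.isElliptic_e13a22; haveI := EisensteinPrimesMazurMCOnCellBKernelCertP13ThirteenthCell.isGloballyMinimal_e13a22
  have hb := baseChange_mk_int 1 (-1) 1 (-7556512459866068) 256180460309112042534709
  push_cast at hb
  intro q hq; fin_cases hq <;> exact dvd_conductorNorm_of_dvd_Δ _ hb (by norm_num) (by rw [intCurve_Δ]; decide +kernel)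

/-- **Forward edges and anchors from ANY curve `W₁` isogenous to `E` (cell Y): a field Heegner for `N_{W₁}` with `d < −4` has `d ≤ −2495`** — `N_{W₁} = N_E` granted modularity
(`ModularForms.conductorNorm_eq_of_isIsogenous_of_modularity`, Atkin–Lehner) and the landed `discr_le_of_heegner_e13a22`. [cite: AtkinLehner1970, Thm. 4] [cite: GrossLMS1991, §1 (p. 235)] -/
theorem discr_le_of_heegner_isogenous_e13a22 (hmod : nonempty_modularParametrizationData) (W₁ : WeierstrassCurve ℚ) [W₁.IsElliptic]
    (hiso : IsIsogenous (⟨1, -1, 1, -7556512459866068, 256180460309112042534709⟩ : WeierstrassCurve ℚ) W₁) (K₀ : Type) [Field K₀] [NumberField K₀] (hK : IsImaginaryQuadratic K₀)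
    (hHN : SatisfiesHeegnerHypothesis (W₁.conductorNorm ℤ) K₀) (hlt : NumberField.discr K₀ < -4) : NumberField.discr K₀ ≤ -2495 := by
  haveI := EisensteinPrimesMazurMCOnCellBKernelCertP13ThirteenthCell.isElliptic_e13a22
  rw [← conductorNorm_eq_of_isIsogenous_of_modularity hmod _ W₁ hiso] at hHN
  exact EisensteinPrimesMazurMCOnCellBKernelCertP13DoorPriceII.discr_le_of_heegner_e13a22 K₀ hK hHN hlt

/-- Finite residue check for reverse edges at cell Y: no `D ∈ (−615, −4)` with `D ≡ 1 (8)`, `(D/13) = 1` and `q ∣ D ∨ (D/q) = 1` for `q ∈ [3, 7, 13, 23, 29, 113]`. [folklore] -/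
theorem no_reverse_discr_e13a22 : ∀ D ∈ Finset.Ioo (-615 : ℤ) (-4), D % 8 = 1 → (D : ZMod 13) ^ 6 = 1 →
    (∀ q ∈ ([3, 7, 13, 23, 29, 113] : List ℕ), (q : ℤ) ∣ D ∨ (D : ZMod q) ^ (q / 2) = 1) → False := by
  decide +kernel

/-- **REVERSE edges into ANY curve `W₁` isogenous to `E` (cell Y): every `TwoStepAt 13 U W₁` has second field `K″` with `d_{K″} ≤ −615` and carries an analytic-rank-ONE
certificate for a curve `Wd` with `W₁ ≅ Wd ⊗ χ_{d_{K″}}`** (granted modularity for `N_{W₁} = N_E`). The first step of every zig-zag of 6⁷'s left door out of the class of `E` is thus an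
`L`-reading: forward `r_an(W₁^{(d)}) = 1`, `|d| ≥ 2495`, or reverse `r_an(Wd) = 1`, `Wd ≅ W₁ ⊗ χ_d`, `|d| ≥ 615`. [cite: GrossLMS1991, §1 (p. 235)] [cite: AtkinLehner1970, Thm. 4] -/
theorem twoStepAt_into_isogenous_e13a22 (hmod : nonempty_modularParametrizationData) (W₁ : WeierstrassCurve ℚ) [W₁.IsElliptic]
    (hiso : IsIsogenous (⟨1, -1, 1, -7556512459866068, 256180460309112042534709⟩ : WeierstrassCurve ℚ) W₁) (U : WeierstrassCurve ℚ) (h : TwoStepAt 13 U W₁) :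
    ∃ (K : Type) (_ : Field K) (_ : NumberField K), IsImaginaryQuadratic K ∧ NumberField.discr K ≤ -615 ∧
      ∃ (Wd : WeierstrassCurve ℚ) (_ : Wd.IsElliptic) (_ : Wd.IsGloballyMinimal),
        (∃ C : VariableChange ℚ, C • W₁ = Wd.quadraticTwist (NumberField.discr K : ℚ)) ∧ Wd.analyticRank = 1 := by
  haveI := EisensteinPrimesMazurMCOnCellBKernelCertP13ThirteenthCell.isElliptic_e13a22
  have hN := conductorNorm_eq_of_isIsogenous_of_modularity hmod _ W₁ hiso
  have hb := bad_dvd_conductorNorm_e13a22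
  exact discr_le_of_twoStepAt_into_of_check [3, 7, 13, 23, 29, 113] (hN ▸ hb 2 (by simp)) (by intro q hq; fin_cases hq <;> exact ⟨by norm_num, by decide, hN ▸ hb _ (by simp)⟩)
    (-615) no_reverse_discr_e13a22 U h

end Summit.BirchSwinnertonDyer.BirchSwinnertonDyer.Theorems.EisensteinPrimesMazurMCOnCellBKernelCertP13DoorPriceClassII
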